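import Summits.AtomisticToContinuum.FouriersLaw.Theorems.IncoherentChannel.Negative.HarmonicFlow
import Literature.MathematicalPhysics.KineticTheory.LangevinChainDynkin

/-!
# IncoherentChannel, harmonic corner (2/4): kernel moments from CEHR (3.4) and the harmonic kernel acting on `p_i`, `p_i²`

Negative-side support for crux `PhononMeanFreePath.IncoherentChannel` (item stmt-AtomisticToContinuum-11811),
`Disproof.lean` §5 continued (sorry-free, no definitions). For every chain of the family with
`ω₂ > 0`, `lam, β, γ ≥ 0`, `T > 0`: coercivity `‖x‖² ≤ 2max(ω₂⁻¹,1)·H`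
(`norm_sq_le_mul_hamiltonian`), `e^{H/(2T)}` integrable for the CONSTRUCTED equal-temperature
transition kernels (`integrable_exp_hamiltonian_transitionKernel`, CEHR (3.4) for
`pinnedChainSemigroup`), hence `p_i`, `p_i²` kernel-integrable. For the harmonic chain:
`harmonic_kernel_momentum` (`P_t p_i(x) = (M_t x)_{p_i} + P_t p_i(0)`) and
`harmonic_kernel_momentum_sq` (`P_t p_i²(x) = (M_t x)_{p_i}² + 2(M_t x)_{p_i} P_t p_i(0) + P_t p_i²(0)`).
-/

noncomputable section

open MeasureTheory Filter Topology Set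
open scoped NNReal
open Literature.MathematicalPhysics.KineticTheory.HeatConduction
open Literature.Probability.Process
open Literature.Barriers.AtomisticToContinuum.HeatConduction (hamiltonian_smul)
open Summit.AtomisticToContinuum.FouriersLaw.Theses.PhononMeanFreePath
open Summit.AtomisticToContinuum.FouriersLaw.Theorems.IncoherentChannel.Negative.HarmonicFlow

namespace Summit.AtomisticToContinuum.FouriersLaw.Theorems.IncoherentChannel.Negative.KernelMoments

section KernelMoments

variable {ω₂ lam β γ : ℝ} (hω : 0 < ω₂) (hl : 0 ≤ lam) (hβ : 0 ≤ β) (hγ : 0 ≤ γ) {n : ℕ} (hn : 0 < n)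
  {T : ℝ} (hT : 0 < T)

/-- `p_i²/2 ≤ H` for the pinned chain (`ω₂ > 0`, `lam, β ≥ 0`). [folklore] -/
theorem sq_momentum_le_two_mul_hamiltonian (hω : 0 < ω₂) (hl : 0 ≤ lam) (hβ : 0 ≤ β) (γ : ℝ)
    (x : PhaseSpace n) (i : Fin n) :
    x.2 i ^ 2 ≤ 2 * (pinnedChain ω₂ lam β γ).hamiltonian n x := by
  have h := pinnedChain_harmonic_le_hamiltonian (ω₂ := ω₂) hl hβ γ n x
  have h1 : x.2 i ^ 2 / 2 ≤ ∑ j, x.2 j ^ 2 / 2 :=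
    Finset.single_le_sum (f := fun j => x.2 j ^ 2 / 2) (fun j _ => by positivity) (Finset.mem_univ i)
  have h2 : 0 ≤ ∑ j, ω₂ * x.1 j ^ 2 / 2 := Finset.sum_nonneg fun j _ => by positivity
  linarith

/-- `ω₂ q_i²/2 ≤ H`. [folklore] -/
theorem sq_position_le_hamiltonian (hω : 0 < ω₂) (hl : 0 ≤ lam) (hβ : 0 ≤ β) (γ : ℝ)
    (x : PhaseSpace n) (i : Fin n) :
    ω₂ * x.1 i ^ 2 ≤ 2 * (pinnedChain ω₂ lam β γ).hamiltonian n x := by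
  have h := pinnedChain_harmonic_le_hamiltonian (ω₂ := ω₂) hl hβ γ n x
  have h1 : ω₂ * x.1 i ^ 2 / 2 ≤ ∑ j, ω₂ * x.1 j ^ 2 / 2 :=
    Finset.single_le_sum (f := fun j => ω₂ * x.1 j ^ 2 / 2) (fun j _ => by positivity) (Finset.mem_univ i)
  have h2 : 0 ≤ ∑ j, x.2 j ^ 2 / 2 := Finset.sum_nonneg fun j _ => by positivity
  linarith

/-- **Coercivity in the sup norm**: `‖x‖² ≤ 2 max(ω₂⁻¹, 1) · H(x)`. [folklore] -/
theorem norm_sq_le_mul_hamiltonian (hω : 0 < ω₂) (hl : 0 ≤ lam) (hβ : 0 ≤ β) (γ : ℝ) (x : PhaseSpace n) :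
    ‖x‖ ^ 2 ≤ 2 * max ω₂⁻¹ 1 * (pinnedChain ω₂ lam β γ).hamiltonian n x := by
  set H := (pinnedChain ω₂ lam β γ).hamiltonian n x with hH
  have hH0 : 0 ≤ H := pinnedChain_hamiltonian_nonneg hω.le hl hβ γ n x
  set c : ℝ := 2 * max ω₂⁻¹ 1 with hc
  have hc0 : 0 ≤ c := by positivity
  have hcoord : ∀ u : ℝ, u ^ 2 ≤ c * H → |u| ≤ Real.sqrt (c * H) := fun u hu => Real.abs_le_sqrt hu
  have hq : ∀ i, |x.1 i| ≤ Real.sqrt (c * H) := by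
    intro i
    apply hcoord
    have h := sq_position_le_hamiltonian hω hl hβ γ x i
    have hω' : x.1 i ^ 2 = ω₂⁻¹ * (ω₂ * x.1 i ^ 2) := by field_simp
    rw [hω']
    calc ω₂⁻¹ * (ω₂ * x.1 i ^ 2) ≤ ω₂⁻¹ * (2 * H) := by
          exact mul_le_mul_of_nonneg_left h (inv_nonneg.2 hω.le)
      _ ≤ c * H := by
          rw [hc]
          have : ω₂⁻¹ ≤ max ω₂⁻¹ 1 := le_max_left _ _
          nlinarith
  have hp : ∀ i, |x.2 i| ≤ Real.sqrt (c * H) := by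
    intro i
    apply hcoord
    have h := sq_momentum_le_two_mul_hamiltonian hω hl hβ γ x i
    calc x.2 i ^ 2 ≤ 2 * H := h
      _ ≤ c * H := by
          rw [hc]
          have : (1 : ℝ) ≤ max ω₂⁻¹ 1 := le_max_right _ _
          nlinarith
  have hnorm : ‖x‖ ≤ Real.sqrt (c * H) := by
    rw [Prod.norm_def]
    refine max_le ?_ ?_
    · exact (pi_norm_le_iff_of_nonneg (Real.sqrt_nonneg _)).2 fun i => by
        rw [Real.norm_eq_abs]; exact hq i
    · exact (pi_norm_le_iff_of_nonneg (Real.sqrt_nonneg _)).2 fun i => by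
        rw [Real.norm_eq_abs]; exact hp i
  calc ‖x‖ ^ 2 ≤ Real.sqrt (c * H) ^ 2 := pow_le_pow_left₀ (norm_nonneg _) hnorm 2
    _ = c * H := Real.sq_sqrt (by positivity)

include hω hl hβ hγ hn hT in
/-- `e^{H/(2T)}` is integrable for every equal-temperature transition kernel (CEHR (3.4) for the
constructed semigroup, `θ = 1/(2T)`). [cite: CuneoEckmannHairerReyBellet2018, §3 eq. (3.4)] -/
theorem integrable_exp_hamiltonian_transitionKernel (t : ℝ≥0) (z : PhaseSpace n) :
    Integrable (fun y => Real.exp (1 / (2 * T) * (pinnedChain ω₂ lam β γ).hamiltonian n y))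
      ((pinnedChain ω₂ lam β γ).transitionKernel n T T t z) := by
  have hθ : 0 < 1 / (2 * T) := by positivity
  have hθ' : 1 / (2 * T) < 1 / max T T := by
    rw [max_self]
    exact one_div_lt_one_div_of_lt hT (by linarith)
  have hbound := lintegral_exp_mul_hamiltonian_pinnedChainSemigroup_le hω hl hβ hγ hn hT.le hT.le hT hT
    hθ hθ' t z
  have hHc : Continuous ((pinnedChain ω₂ lam β γ).hamiltonian n) :=
    (pinnedChain_contDiff_hamiltonian ω₂ lam β γ n (n := 0)).continuous
  refine ⟨(Real.continuous_exp.comp (continuous_const.mul hHc)).aestronglyMeasurable, ?_⟩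
  unfold HasFiniteIntegral
  have h : ∫⁻ y, ‖Real.exp (1 / (2 * T) * (pinnedChain ω₂ lam β γ).hamiltonian n y)‖ₑ
        ∂((pinnedChain ω₂ lam β γ).transitionKernel n T T t z) =
      ∫⁻ y, ENNReal.ofReal (Real.exp (1 / (2 * T) * (pinnedChain ω₂ lam β γ).hamiltonian n y))
        ∂((pinnedChain ω₂ lam β γ).transitionKernel n T T t z) := by
    refine lintegral_congr fun y => ?_
    rw [Real.enorm_eq_ofReal_abs, abs_of_pos (Real.exp_pos _)]
  rw [h]
  exact lt_of_le_of_lt hbound ENNReal.ofReal_lt_top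

include hω hl hβ hγ hn hT in
/-- `p_i²` is integrable for the equal-temperature kernels. [folklore] -/
theorem integrable_sq_momentum_transitionKernel (t : ℝ≥0) (z : PhaseSpace n) (i : Fin n) :
    Integrable (fun y : PhaseSpace n => y.2 i ^ 2) ((pinnedChain ω₂ lam β γ).transitionKernel n T T t z) := by
  have hE := (integrable_exp_hamiltonian_transitionKernel hω hl hβ hγ hn hT t z).const_mul (2 * (2 * T))
  refine hE.mono' (by fun_prop : Continuous fun y : PhaseSpace n => y.2 i ^ 2).aestronglyMeasurable
    (Eventually.of_forall fun y => ?_)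
  rw [Real.norm_eq_abs, abs_of_nonneg (sq_nonneg _)]
  have h1 := sq_momentum_le_two_mul_hamiltonian hω hl hβ γ y i
  have h2 : 1 / (2 * T) * (pinnedChain ω₂ lam β γ).hamiltonian n y ≤
      Real.exp (1 / (2 * T) * (pinnedChain ω₂ lam β γ).hamiltonian n y) := by
    have := Real.add_one_le_exp (1 / (2 * T) * (pinnedChain ω₂ lam β γ).hamiltonian n y)
    linarith
  have hT0 : T ≠ 0 := hT.ne'
  calc y.2 i ^ 2 ≤ 2 * (pinnedChain ω₂ lam β γ).hamiltonian n y := h1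
    _ = 2 * (2 * T) * (1 / (2 * T) * (pinnedChain ω₂ lam β γ).hamiltonian n y) := by field_simp
    _ ≤ 2 * (2 * T) * Real.exp (1 / (2 * T) * (pinnedChain ω₂ lam β γ).hamiltonian n y) :=
        mul_le_mul_of_nonneg_left h2 (by positivity)

include hω hl hβ hγ hn hT in
/-- `p_i` is integrable for the equal-temperature kernels. [folklore] -/
theorem integrable_momentum_transitionKernel (t : ℝ≥0) (z : PhaseSpace n) (i : Fin n) :
    Integrable (fun y : PhaseSpace n => y.2 i) ((pinnedChain ω₂ lam β γ).transitionKernel n T T t z) := by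
  haveI := pinnedChain_isMarkovKernel_transitionKernel hω hl hβ hγ n T T t
  have h1 := integrable_sq_momentum_transitionKernel hω hl hβ hγ hn hT t z i
  have h2 : Integrable (fun _ : PhaseSpace n => (1 : ℝ)) ((pinnedChain ω₂ lam β γ).transitionKernel n T T t z) :=
    integrable_const 1
  refine (h2.add h1).mono' (by fun_prop : Continuous fun y : PhaseSpace n => y.2 i).aestronglyMeasurable
    (Eventually.of_forall fun y => ?_)
  rw [Real.norm_eq_abs]
  simp only [Pi.add_apply]
  nlinarith [sq_nonneg (|y.2 i| - 1), sq_abs (y.2 i), abs_nonneg (y.2 i)]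

end KernelMoments

section HarmonicKernel

variable {ω₂ γ : ℝ} (hω : 0 < ω₂) (hγ : 0 ≤ γ) {n : ℕ} (hn : 0 < n) {T : ℝ} (hT : 0 < T)
include hω hγ hn hT

/-- **`P_t p_i(x) = (M_t x)_{p_i} + P_t p_i(0)`** for the harmonic kernel. [folklore] -/
theorem harmonic_kernel_momentum (t : ℝ≥0) (x : PhaseSpace n) (i : Fin n) :
    ∫ y, y.2 i ∂((pinnedChain ω₂ 0 0 γ).transitionKernel n T T t x) =
      ((pinnedChain ω₂ 0 0 γ).chainFlow n x 0 t).2 i +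
        ∫ y, y.2 i ∂((pinnedChain ω₂ 0 0 γ).transitionKernel n T T t 0) := by
  haveI := pinnedChain_isMarkovKernel_transitionKernel hω le_rfl le_rfl hγ n T T t
  rw [harmonic_integral_transitionKernel hω hγ n T T t x (fun y => y.2 i)]
  simp only [Prod.snd_add, Pi.add_apply]
  rw [integral_add (integrable_const _) (integrable_momentum_transitionKernel hω le_rfl le_rfl hγ hn hT t 0 i),
    integral_const, probReal_univ, one_smul]

/-- **`P_t p_i²(x) = (M_t x)_{p_i}² + 2 (M_t x)_{p_i} P_t p_i(0) + P_t p_i²(0)`**. [folklore] -/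
theorem harmonic_kernel_momentum_sq (t : ℝ≥0) (x : PhaseSpace n) (i : Fin n) :
    ∫ y, y.2 i ^ 2 ∂((pinnedChain ω₂ 0 0 γ).transitionKernel n T T t x) =
      ((pinnedChain ω₂ 0 0 γ).chainFlow n x 0 t).2 i ^ 2 +
        2 * ((pinnedChain ω₂ 0 0 γ).chainFlow n x 0 t).2 i *
          (∫ y, y.2 i ∂((pinnedChain ω₂ 0 0 γ).transitionKernel n T T t 0)) +
        ∫ y, y.2 i ^ 2 ∂((pinnedChain ω₂ 0 0 γ).transitionKernel n T T t 0) := by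
  haveI := pinnedChain_isMarkovKernel_transitionKernel hω le_rfl le_rfl hγ n T T t
  set a := ((pinnedChain ω₂ 0 0 γ).chainFlow n x 0 t).2 i with ha
  rw [harmonic_integral_transitionKernel hω hγ n T T t x (fun y => y.2 i ^ 2)]
  simp only [Prod.snd_add, Pi.add_apply]
  have hI1 := integrable_momentum_transitionKernel hω le_rfl le_rfl hγ hn hT t (0 : PhaseSpace n) i
  have hI2 := integrable_sq_momentum_transitionKernel hω le_rfl le_rfl hγ hn hT t (0 : PhaseSpace n) i
  have hsplit : (fun y : PhaseSpace n => (a + y.2 i) ^ 2) =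
      fun y => (a ^ 2 + 2 * a * y.2 i) + y.2 i ^ 2 := by
    funext y; ring
  have hI3 : Integrable (fun y : PhaseSpace n => a ^ 2 + 2 * a * y.2 i)
      ((pinnedChain ω₂ 0 0 γ).transitionKernel n T T t 0) := (integrable_const _).add (hI1.const_mul _)
  have hI4 : Integrable (fun y : PhaseSpace n => 2 * a * y.2 i)
      ((pinnedChain ω₂ 0 0 γ).transitionKernel n T T t 0) := hI1.const_mul _
  rw [← ha, hsplit, integral_add hI3 hI2, integral_add (integrable_const _) hI4, integral_const_mul,
    integral_const, probReal_univ, one_smul]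

end HarmonicKernel

end Summit.AtomisticToContinuum.FouriersLaw.Theorems.IncoherentChannel.Negative.KernelMoments
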